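import Summits.CriticalPhenomena.PercolationContinuityZ3.Theorems.PercNearOneGluingNoHeavyLowerTailQuantitativeAntitheticDeletionReduction
import HarnessLib

/-!
# Two exact steps of the arm-peeling induction: a leaf at `x` contributes nothing, a doubled spoke is inert (PROOFS §P70 (o),(p); BENCH M2-R108/M2-R109)

Support file (`--supports stmt-CriticalPhenomena-4575`), prover seat `prim-rate-mine-2` (lane prim-rate, constants-miner (c);
`run/shared/lean/prim/prim-rate/prim-rate-mine-2/PROOFS.md` §P70).  No definitions, no named facts, no sorries; standard axioms.

SETTING (cube form, as `…QuantitativeAntitheticDegTwoReduction`; the toggling reindexings of that file are re-derived inline here from `Equiv.sum_comp`, so that this file imports only `…QuantitativeAntitheticDeletionReduction`): `α` = all potential pairs, `P` = the graph's pair set, colourings `X ∩ P`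
(red) / `P \ X` (blue), readers `T F G : Finset α → ℤ`, inflated antithetic functional
`Φ(P) = Σ_X (T(X∩P) + T(P∖X) + C)(F(X∩P) − F(P∖X))(G(X∩P) − G(P∖X))`.
The TWO-ARM THEOREM of PROOFS §P70 (p) (Φ is bilinear in the lengths of hub–path arms at `b` and `u`) and THEOREM T2 (§P70 (o)) peel the
end pair `e = b v₂` of an arm with the one-pair identity `Φ(G) = Φ(G − e) + Φ(G / e) − Σδ` and use two exact facts, proved here abstractly:

* `CSH.antithetic_sum_eq_zero_of_toggle_odd` — a summand that changes sign under toggling one coordinate sums to zero;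
  `CSH.antithetic_leafSpoke_eq_zero` — **STEP (1): `Φ(G − e) = 0`** when the terminal `b` is a LEAF AT `x`: its reading is the colour of its spoke
  `s` (`F Y = [s ∈ Y]` on `Y ⊆ P`) while `T, G` ignore `s`; toggling `s` flips the sign of the summand.
* `CSH.antithetic_doubledPair_inert` — **STEP (2): a DOUBLED spoke (two parallel pairs `g ≠ g'` at `b`) is inert: `Φ(P) = ½·Φ(P.erase g')`**
  (inflated normalisation; on genuine colourings `Φ(G with the doubled pair) = Φ(G with one copy)`), from the graph facts: if exactly one copy is red
  then `b` is joined to `x` in both colours, so `F = 1` on both readings and the summand vanishes (`hdiff`); if both copies have the same colour the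
  readings are those of the single-copy graph (`hsame_in`, `hsame_out`).
[cite: VandenbergHaggstromKahn2005, Thm. 1.3 (p. 6)] [cite: Harris1960, Lemma 4.1 (p. 16)]
-/

namespace Summit.CriticalPhenomena.PercolationContinuityZ3.Theorems.CSH

open Finset
open scoped symmDiff

variable {α : Type*} [Fintype α] [DecidableEq α]

/-- A function on the cube that is odd under toggling one coordinate sums to zero. [cite: Harris1960, Lemma 4.1 (p. 16)] -/
theorem antithetic_sum_eq_zero_of_toggle_odd (e : α) (h : Finset α → ℚ)
    (hodd : ∀ X : Finset α, h (X ∆ {e}) = - h X) :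
    (∑ X : Finset α, h X) = 0 := by
  have h1 : (∑ X : Finset α, h (X ∆ {e})) = ∑ X : Finset α, h X :=
    Equiv.sum_comp (Function.Involutive.toPerm (fun X : Finset α => X ∆ ({e} : Finset α))
      (fun X => symmDiff_symmDiff_cancel_right ({e} : Finset α) X)) h
  have h2 : (∑ X : Finset α, h (X ∆ {e})) = - ∑ X : Finset α, h X := by
    rw [← Finset.sum_neg_distrib]
    exact Finset.sum_congr rfl fun X _ => hodd X
  linarith

/-- **STEP (1) of the arm peeling: a terminal that is a leaf at `x` contributes nothing.**  If `s ∈ P` is the spoke of `b` and `b` has no other pair,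
then `b`'s reading is the colour of `s` (`hF`) while the readers `T, G` ignore `s` (`hT`, `hG`); the inflated antithetic functional of `P` vanishes.
(PROOFS §P70 (p), proof step (1): `Φ(G − e) = 0`.) [cite: Harris1960, Lemma 4.1 (p. 16)] -/
theorem antithetic_leafSpoke_eq_zero (T F G : Finset α → ℤ) (P : Finset α) (s : α) (C : ℚ) (hs : s ∈ P)
    (hF : ∀ Y, Y ⊆ P → F Y = if s ∈ Y then 1 else 0)
    (hT : ∀ Y, Y ⊆ P → T (Y.erase s) = T Y) (hG : ∀ Y, Y ⊆ P → G (Y.erase s) = G Y) :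
    (∑ X : Finset α, ((T (X ∩ P) : ℚ) + (T (P \ X) : ℚ) + C) *
        (((F (X ∩ P) : ℚ) - (F (P \ X) : ℚ)) * ((G (X ∩ P) : ℚ) - (G (P \ X) : ℚ)))) = 0 := by
  apply antithetic_sum_eq_zero_of_toggle_odd s
  intro X
  -- readings off `s` are toggle-invariant
  have r1 : ((X ∆ {s}) ∩ P) \ {s} = (X ∩ P) \ {s} := by
    ext y
    simp only [mem_sdiff, mem_inter, mem_symmDiff, mem_singleton]
    constructor
    · rintro ⟨⟨h1, hP⟩, hy⟩
      rcases h1 with ⟨hX, -⟩ | ⟨hys, -⟩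
      · exact ⟨⟨hX, hP⟩, hy⟩
      · exact absurd hys hy
    · rintro ⟨⟨hX, hP⟩, hy⟩
      exact ⟨⟨Or.inl ⟨hX, hy⟩, hP⟩, hy⟩
  have b1 : (P \ (X ∆ {s})) \ {s} = (P \ X) \ {s} := by
    ext y
    simp only [mem_sdiff, mem_symmDiff, mem_singleton, not_or, not_and, not_not]
    constructor
    · rintro ⟨⟨hP, h1, -⟩, hy⟩
      exact ⟨⟨hP, fun hX => hy (h1 hX)⟩, hy⟩
    · rintro ⟨⟨hP, hX⟩, hy⟩
      exact ⟨⟨hP, fun h => absurd h hX, fun hys => absurd hys hy⟩, hy⟩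
  have eT : ∀ V : Finset α, (T (V ∩ P) : ℚ) = T ((V ∩ P) \ {s}) := fun V => by
    rw [← hT (V ∩ P) inter_subset_right, sdiff_singleton_eq_erase]
  have eT' : ∀ V : Finset α, (T (P \ V) : ℚ) = T ((P \ V) \ {s}) := fun V => by
    rw [← hT (P \ V) sdiff_subset, sdiff_singleton_eq_erase]
  have eG : ∀ V : Finset α, (G (V ∩ P) : ℚ) = G ((V ∩ P) \ {s}) := fun V => by
    rw [← hG (V ∩ P) inter_subset_right, sdiff_singleton_eq_erase]
  have eG' : ∀ V : Finset α, (G (P \ V) : ℚ) = G ((P \ V) \ {s}) := fun V => by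
    rw [← hG (P \ V) sdiff_subset, sdiff_singleton_eq_erase]
  have eF : ∀ V : Finset α, (F (V ∩ P) : ℚ) = if s ∈ V then 1 else 0 := fun V => by
    rw [hF (V ∩ P) inter_subset_right]
    have : s ∈ V ∩ P ↔ s ∈ V := by simp [hs]
    simp only [this]; split_ifs <;> simp
  have eF' : ∀ V : Finset α, (F (P \ V) : ℚ) = if s ∈ V then 0 else 1 := fun V => by
    rw [hF (P \ V) sdiff_subset]
    have : s ∈ P \ V ↔ s ∉ V := by simp [hs]
    simp only [this]; split_ifs <;> simp_all
  have ms : s ∈ X ∆ {s} ↔ s ∉ X := by simp [mem_symmDiff]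
  rw [eT (X ∆ {s}), eT' (X ∆ {s}), eG (X ∆ {s}), eG' (X ∆ {s}), eF (X ∆ {s}), eF' (X ∆ {s}),
    eT X, eT' X, eG X, eG' X, eF X, eF' X, r1, b1]
  simp only [ms]
  by_cases hX : s ∈ X <;> simp [hX] <;> ring

/-- **STEP (2) of the arm peeling: a doubled pair is inert.**  Pairs `g ≠ g'` of `P` are two copies of the spoke of `b`: if exactly one copy is red
then `b` is joined to `x` in both colours and its reading is `1` on both sides (`hdiff`), if both copies have the same colour the readings are those of
the single-copy graph `P.erase g'` (`hsame_in`, `hsame_out`).  Then the inflated functional of `P` is half that of `P.erase g'` — i.e. on genuine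
colourings the doubled graph and the single-copy graph have the SAME functional (PROOFS §P70 (p), proof step (2): `Φ(G/e) = Φ(G(k_L − 1, k_R))`).
[cite: VandenbergHaggstromKahn2005, Thm. 1.3 (p. 6)] -/
theorem antithetic_doubledPair_inert (T F G T₁ F₁ G₁ : Finset α → ℤ) (P : Finset α) (g g' : α) (C : ℚ)
    (hgg : g ≠ g') (hg : g ∈ P) (hg' : g' ∈ P)
    (hdiff : ∀ Y, Y ⊆ P → (g ∈ Y ↔ g' ∉ Y) → F Y = 1)
    (hsame_in : ∀ Y, Y ⊆ P → g ∈ Y → g' ∈ Y → T Y = T₁ (Y.erase g') ∧ F Y = F₁ (Y.erase g') ∧ G Y = G₁ (Y.erase g'))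
    (hsame_out : ∀ Y, Y ⊆ P → g ∉ Y → g' ∉ Y → T Y = T₁ Y ∧ F Y = F₁ Y ∧ G Y = G₁ Y) :
    2 * (∑ X : Finset α, ((T (X ∩ P) : ℚ) + (T (P \ X) : ℚ) + C) *
        (((F (X ∩ P) : ℚ) - (F (P \ X) : ℚ)) * ((G (X ∩ P) : ℚ) - (G (P \ X) : ℚ))))
    = ∑ X : Finset α, ((T₁ (X ∩ P.erase g') : ℚ) + (T₁ (P.erase g' \ X) : ℚ) + C) *
        (((F₁ (X ∩ P.erase g') : ℚ) - (F₁ (P.erase g' \ X) : ℚ)) * ((G₁ (X ∩ P.erase g') : ℚ) - (G₁ (P.erase g' \ X) : ℚ))) := by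
  set P' : Finset α := P.erase g' with hP'
  set Ψ : Finset α → ℚ := fun X => ((T (X ∩ P) : ℚ) + (T (P \ X) : ℚ) + C) *
        (((F (X ∩ P) : ℚ) - (F (P \ X) : ℚ)) * ((G (X ∩ P) : ℚ) - (G (P \ X) : ℚ))) with hΨ
  set Ψ₁ : Finset α → ℚ := fun X => ((T₁ (X ∩ P') : ℚ) + (T₁ (P' \ X) : ℚ) + C) *
        (((F₁ (X ∩ P') : ℚ) - (F₁ (P' \ X) : ℚ)) * ((G₁ (X ∩ P') : ℚ) - (G₁ (P' \ X) : ℚ))) with hΨ₁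
  -- pointwise: Ψ X + Ψ (X ∆ {g'}) = Ψ₁ X  (exactly one of the two has the copies equally coloured; the other vanishes; Ψ₁ ignores g')
  have key : ∀ X : Finset α, Ψ X + Ψ (X ∆ {g'}) = Ψ₁ X := by
    intro X
    have mg' : g' ∈ X ∆ {g'} ↔ g' ∉ X := by simp [mem_symmDiff]
    have mg : g ∈ X ∆ {g'} ↔ g ∈ X := by simp [mem_symmDiff, hgg]
    -- set identities
    have i1 : ∀ V : Finset α, g' ∈ V → (V ∩ P).erase g' = V ∩ P' := fun V hV => by
      ext y; simp only [hP', mem_erase, mem_inter]; tauto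
    have i2 : ∀ V : Finset α, g' ∉ V → V ∩ P = V ∩ P' := fun V hV => by
      ext y; simp only [hP', mem_erase, mem_inter]
      constructor
      · rintro ⟨h1, h2⟩; exact ⟨h1, fun h => hV (h ▸ h1), h2⟩
      · rintro ⟨h1, -, h2⟩; exact ⟨h1, h2⟩
    have i3 : ∀ V : Finset α, g' ∉ V → (P \ V).erase g' = P' \ V := fun V hV => by
      ext y; simp only [hP', mem_erase, mem_sdiff]; tauto
    have i4 : ∀ V : Finset α, g' ∈ V → P \ V = P' \ V := fun V hV => by
      ext y; simp only [hP', mem_erase, mem_sdiff]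
      constructor
      · rintro ⟨h1, h2⟩; exact ⟨⟨fun h => h2 (h ▸ hV), h1⟩, h2⟩
      · rintro ⟨⟨-, h1⟩, h2⟩; exact ⟨h1, h2⟩
    -- vanishing when the copies differ: F = 1 on both readings
    have van : ∀ V : Finset α, (g ∈ V ↔ g' ∉ V) → Ψ V = 0 := by
      intro V hV
      have f1 : F (V ∩ P) = 1 := hdiff (V ∩ P) inter_subset_right (by simpa [hg, hg'] using hV)
      have f2 : F (P \ V) = 1 := hdiff (P \ V) sdiff_subset (by simp [hg, hg']; tauto)
      simp only [hΨ, f1, f2]; ring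
    -- equal readings when the copies agree
    have same : ∀ V : Finset α, (g ∈ V ↔ g' ∈ V) → Ψ V = Ψ₁ V := by
      intro V hV
      by_cases h' : g' ∈ V
      · have hgV : g ∈ V := hV.2 h'
        obtain ⟨t1, f1, e1⟩ := hsame_in (V ∩ P) inter_subset_right (by simp [hgV, hg]) (by simp [h', hg'])
        obtain ⟨t2, f2, e2⟩ := hsame_out (P \ V) sdiff_subset (by simp [hgV]) (by simp [h'])
        have hT1 : T (V ∩ P) = T₁ (V ∩ P') := by rw [t1, i1 V h']
        have hF1 : F (V ∩ P) = F₁ (V ∩ P') := by rw [f1, i1 V h']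
        have hG1 : G (V ∩ P) = G₁ (V ∩ P') := by rw [e1, i1 V h']
        have hT2 : T (P \ V) = T₁ (P' \ V) := by rw [t2, i4 V h']
        have hF2 : F (P \ V) = F₁ (P' \ V) := by rw [f2, i4 V h']
        have hG2 : G (P \ V) = G₁ (P' \ V) := by rw [e2, i4 V h']
        simp only [hΨ, hΨ₁, hT1, hF1, hG1, hT2, hF2, hG2]
      · have hgV : g ∉ V := fun h => h' (hV.1 h)
        obtain ⟨t1, f1, e1⟩ := hsame_out (V ∩ P) inter_subset_right (by simp [hgV]) (by simp [h'])
        obtain ⟨t2, f2, e2⟩ := hsame_in (P \ V) sdiff_subset (by simp [hgV, hg]) (by simp [h', hg'])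
        have hT1 : T (V ∩ P) = T₁ (V ∩ P') := by rw [t1, i2 V h']
        have hF1 : F (V ∩ P) = F₁ (V ∩ P') := by rw [f1, i2 V h']
        have hG1 : G (V ∩ P) = G₁ (V ∩ P') := by rw [e1, i2 V h']
        have hT2 : T (P \ V) = T₁ (P' \ V) := by rw [t2, i3 V h']
        have hF2 : F (P \ V) = F₁ (P' \ V) := by rw [f2, i3 V h']
        have hG2 : G (P \ V) = G₁ (P' \ V) := by rw [e2, i3 V h']
        simp only [hΨ, hΨ₁, hT1, hF1, hG1, hT2, hF2, hG2]
    -- Ψ₁ ignores g'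
    have inv : Ψ₁ (X ∆ {g'}) = Ψ₁ X := by
      have r1 : (X ∆ {g'}) ∩ P' = X ∩ P' := by
        ext y; simp only [mem_inter, mem_symmDiff, hP', mem_erase, mem_singleton]
        constructor
        · rintro ⟨h1, h2, h3⟩; rcases h1 with ⟨hx, -⟩ | ⟨hy, -⟩; exact ⟨hx, h2, h3⟩; exact absurd hy h2
        · rintro ⟨hx, h2, h3⟩; exact ⟨Or.inl ⟨hx, h2⟩, h2, h3⟩
      have r2 : P' \ (X ∆ {g'}) = P' \ X := by
        ext y; simp only [mem_sdiff, mem_symmDiff, hP', mem_erase, mem_singleton, not_or, not_and, not_not]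
        constructor
        · rintro ⟨⟨h2, h3⟩, h4, -⟩; exact ⟨⟨h2, h3⟩, fun hx => h2 (h4 hx)⟩
        · rintro ⟨⟨h2, h3⟩, h4⟩; exact ⟨⟨h2, h3⟩, fun hx => absurd hx h4, fun hy => absurd hy h2⟩
      simp only [hΨ₁, r1, r2]
    by_cases h' : g' ∈ X
    · by_cases h : g ∈ X
      · rw [same X ⟨fun _ => h', fun _ => h⟩, van (X ∆ {g'}) (by rw [mg, mg']; exact ⟨fun _ => not_not.2 h', fun _ => h⟩)]; ring
      · rw [van X ⟨fun hx => absurd hx h, fun hn => absurd h' hn⟩, same (X ∆ {g'}) (by rw [mg, mg']; tauto), inv]; ring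
    · by_cases h : g ∈ X
      · rw [van X ⟨fun _ => h', fun _ => h⟩, same (X ∆ {g'}) (by rw [mg, mg']; tauto), inv]; ring
      · rw [same X ⟨fun hx => absurd hx h, fun hx => absurd hx h'⟩, van (X ∆ {g'}) (by rw [mg, mg']; tauto)]; ring
  have hsum : (∑ X : Finset α, Ψ X) + (∑ X : Finset α, Ψ (X ∆ {g'})) = ∑ X : Finset α, Ψ₁ X := by
    rw [← Finset.sum_add_distrib]; exact Finset.sum_congr rfl fun X _ => key X
  have htog : (∑ X : Finset α, Ψ (X ∆ {g'})) = ∑ X : Finset α, Ψ X :=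
    Equiv.sum_comp (Function.Involutive.toPerm (fun X : Finset α => X ∆ ({g'} : Finset α))
      (fun X => symmDiff_symmDiff_cancel_right ({g'} : Finset α) X)) Ψ
  rw [htog] at hsum
  simp only [hΨ, hΨ₁] at hsum ⊢
  linarith

end Summit.CriticalPhenomena.PercolationContinuityZ3.Theorems.CSH
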